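import Mathlib
import Literature.NumberTheory.Transcendental.SemialgebraicMapsProofs
import Literature.NumberTheory.Transcendental.SemialgebraicLineDeriv
import Summits.KontsevichZagierPeriods.KontsevichZagierPeriods.Theorems.TorsionLogsNeronTorsionSectorStubHaarReps
import Summits.KontsevichZagierPeriods.KontsevichZagierPeriods.Theorems.TorsionLogsNeronTorsionSectorStubTranslationStep
import HarnessLib

/-!
# Stub `stub_upStepInst` — crux `TorsionLogs.NeronTorsionSector`, line `registered` (block S1)

The regular UP-STEP of the translation chain on the real torus of `y² = f(x) = 4x³ − g₂x − g₃`: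
`t_{j+1} ≡ t_j + [row j, (q_{j+1} − Qf)/√f]`. The source half-cell is
`Tsrc = [{b < x′ < x < c}, h(x′)/(√f(x)√f(x′))]` over the row `(b, c)` with the regular second-kind
kernel `h = (g₂x + 2g₃)/(4x²)`, the target half-cell `Ttgt` is the same datum over the next row
`(b′, c′) = τ((b, c))` (`τ` the translation by `P₁`, strictly increasing on `[b, c]`), and the output
is `rO = [(b, c), (Qf b − Qf x)/√f(x)]`.

This is ONE application of the landed generic translation step `stub_translationStep` with
`φ = ψ = τ`, `A = B = (b, c)`, `A′ = B′ = (b′, c′)`, `J = [b, c]`, all four weights `1/√f` (the Haar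
identity `|τ′|√f = √f∘τ` gives `(√f(τ x))⁻¹ |τ′ x| = (√f x)⁻¹`), kernels `kS = kT = h`, fibres
`(b, x)`, potential `Q = Qf` (`Qf′ = (h∘τ − h)/(−√f)`); the image of the triangle `{b < x′ < x < c}`
under `τ × τ` is the next triangle by strict monotonicity and `τ((b, c)) = (b′, c′)`.

References: M. Kontsevich, D. Zagier, *Periods* (2001), §1.2 rules (1)–(3); J. Bochnak, M. Coste,
M.-F. Roy, *Real Algebraic Geometry* (1998), §2.2, Prop. 2.2.6.
-/

noncomputable section

-- `Summit.KontsevichZagierPeriods.KontsevichZagierPeriods.…` is the tree's mandated layout (single-conjunct summit).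
set_option linter.dupNamespace false

open Set MeasureTheory MvPolynomial
open Literature.NumberTheory.Transcendental Literature.ModelTheory.ExponentialFields
open Literature.NumberTheory.Transcendental.KZ

namespace Summit.KontsevichZagierPeriods.KontsevichZagierPeriods.Cruxes.NeronTorsionSector.Translation

/-- **The regular second-kind kernel `h = (g₂x + 2g₃)/(4x²)` in one coordinate is
`ℚ`-semialgebraic** on every `ℚ`-semialgebraic `S ⊆ ℝ¹` (algebraic constants `g₂, g₃`; closure of
real `ℚ`-semialgebraic functions under `+`, `×` and the junk-tolerant inverse).
[cite: BochnakCosteRoy1998, Prop. 2.2.6] -/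
theorem upStep_isSemialgebraicFunOn_kernel {S : Set (Fin 1 → ℝ)} (hS : IsSemialgebraic ℚ S)
    {g₂ g₃ : ℝ} (h₂ : IsAlgebraic ℚ g₂) (h₃ : IsAlgebraic ℚ g₃) :
    IsSemialgebraicFunOn ℚ S (fun t => (g₂ * t 0 + 2 * g₃) / (4 * t 0 ^ 2)) := by
  have hX : IsSemialgebraicFunOn ℚ S (fun t => t 0) :=
    (isSemialgebraicFunOn_aeval hS (X 0)).congr fun x _ => by simp
  have hnum : IsSemialgebraicFunOn ℚ S (fun t => g₂ * t 0 + 2 * g₃) :=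
    ((isSemialgebraicFunOn_const_of_isAlgebraic hS h₂).fun_mul hX).fun_add
      ((isSemialgebraicFunOn_const_ofNat hS 2).fun_mul (isSemialgebraicFunOn_const_of_isAlgebraic hS h₃))
  have hden : IsSemialgebraicFunOn ℚ S (fun t => 4 * t 0 ^ 2) :=
    (isSemialgebraicFunOn_const_ofNat hS 4).fun_mul (hX.fun_pow 2)
  exact (hnum.fun_mul hden.fun_inv).congr fun _ _ => (div_eq_mul_inv _ _).symm

/-- **The diagonal action of an increasing bijection of rows maps the half-cell onto the half-cell.**
If `τ` is strictly increasing on `[b, c]` and maps `(b, c)` onto `(b′, c′)`, then the triangle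
`{b′ < w₁ < w₀ < c′}` is the image of the triangle `{b < z₁ < z₀ < c}` under `z ↦ (τ z₀, τ z₁)`
(surjectivity gives the preimages, strict monotonicity the order). [cite: KontsevichZagier2001, §1.2] -/
theorem upStep_image_triangle {τ : ℝ → ℝ} {b c b' c' : ℝ} (hmono : StrictMonoOn τ (Set.Icc b c))
    (himg : τ '' Set.Ioo b c = Set.Ioo b' c') :
    {w : Fin 2 → ℝ | b' < w 1 ∧ w 1 < w 0 ∧ w 0 < c'} =
      (fun z : Fin 2 → ℝ => (![τ (z 0), τ (z 1)] : Fin 2 → ℝ)) '' {z | b < z 1 ∧ z 1 < z 0 ∧ z 0 < c} := by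
  ext w
  simp only [mem_setOf_eq, mem_image]
  constructor
  · rintro ⟨h1, h2, h3⟩
    obtain ⟨z0, hz0, e0⟩ : w 0 ∈ τ '' Ioo b c := by
      rw [himg]
      exact ⟨h1.trans h2, h3⟩
    obtain ⟨z1, hz1, e1⟩ : w 1 ∈ τ '' Ioo b c := by
      rw [himg]
      exact ⟨h1, h2.trans h3⟩
    have hlt : z1 < z0 := by
      refine (hmono.lt_iff_lt (Ioo_subset_Icc_self hz1) (Ioo_subset_Icc_self hz0)).1 ?_
      rw [e0, e1]
      exact h2
    refine ⟨![z0, z1], ⟨?_, ?_, ?_⟩, ?_⟩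
    · simpa using hz1.1
    · simpa using hlt
    · simpa using hz0.2
    · funext i
      fin_cases i
      · simpa using e0
      · simpa using e1
  · rintro ⟨z, ⟨h1, h2, h3⟩, rfl⟩
    have hz0 : z 0 ∈ Ioo b c := ⟨h1.trans h2, h3⟩
    have hz1 : z 1 ∈ Ioo b c := ⟨h1, h2.trans h3⟩
    have ht0 : τ (z 0) ∈ Ioo b' c' := by
      rw [← himg]
      exact mem_image_of_mem τ hz0
    have ht1 : τ (z 1) ∈ Ioo b' c' := by
      rw [← himg]
      exact mem_image_of_mem τ hz1
    simp only [Matrix.cons_val_zero, Matrix.cons_val_one]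
    exact ⟨ht1.1, hmono (Ioo_subset_Icc_self hz1) (Ioo_subset_Icc_self hz0) h2, ht0.2⟩

/-- **STUB S1 (`stub_upStepInst`, size M) — the regular up-step `t_{j+1} ≡ t_j + [row j, (q_{j+1} − Qf)/√f]`.**
Source half-cell `t_j = [{b < x′ < x < c}, h(x′)/(√f√f′)]` over the row `(b, c) = (x_{j+1}, x_j)` (`j ≥ 1`), target
half-cell over the next row `(b′, c′) = (x_{j+2}, x_{j+1}) = τ((b,c))` (`τ` increasing): `stub_translationStep` with
`φ = ψ = τ`, `A = B = (b,c)`, `A′ = B′ = (b′,c′)`, `J = [b,c]`, all weights `1/√f` (Haar identity `|τ′|√f = √f∘τ`),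
kernels `kS = kT = h = (g₂x+2g₃)/(4x²)`, fibres `(b, x)`, potential `Q = Qf` (`Qf′ = (h∘τ − h)/yb`, `yb = −√f`); the
image of the triangle under `τ × τ` is the next triangle by monotonicity. [cite: KontsevichZagier2001, §1.2] -/
theorem stub_upStepInst :
    ∀ (g₂ g₃ e₁ b c b' c' Cb : ℝ) (f τ τ' Qf : ℝ → ℝ)
      (Tsrc Ttgt : Literature.NumberTheory.Transcendental.KZ.IntegralRep 2)
      (rO : Literature.NumberTheory.Transcendental.KZ.IntegralRep 1),
    (∀ x, f x = 4 * x ^ 3 - g₂ * x - g₃) → IsAlgebraic ℚ g₂ → IsAlgebraic ℚ g₃ →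
    IsAlgebraic ℚ b → IsAlgebraic ℚ c → IsAlgebraic ℚ b' → IsAlgebraic ℚ c' →
    0 < e₁ → e₁ < b → b < c → e₁ ≤ b' → b' < c' → (∀ x, e₁ < x → 0 < f x) →
    (∀ x, e₁ < x → |(g₂ * x + 2 * g₃) / (4 * x ^ 2)| ≤ Cb) →
    MeasureTheory.IntegrableOn (fun t => (Real.sqrt (f t))⁻¹) (Set.Ioo b c) →
    StrictMonoOn τ (Set.Icc b c) → τ '' Set.Ioo b c = Set.Ioo b' c' →
    (∀ x ∈ Set.Ioo b c, HasDerivAt τ (τ' x) x ∧ |τ' x| * Real.sqrt (f x) = Real.sqrt (f (τ x))) →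
    IsSemialgebraicFunOn ℚ {t : Fin 1 → ℝ | t 0 ∈ Set.Ioo b c} (fun t => τ (t 0)) →
    IsSemialgebraicFunOn ℚ {t : Fin 1 → ℝ | t 0 ∈ Set.Icc b c} (fun t => Qf (t 0)) →
    ContinuousOn Qf (Set.Icc b c) →
    (∀ x ∈ Set.Ioo b c, HasDerivAt Qf
      (((g₂ * τ x + 2 * g₃) / (4 * τ x ^ 2) - (g₂ * x + 2 * g₃) / (4 * x ^ 2)) / (-Real.sqrt (f x))) x) →
    Tsrc.domain = {z | b < z 1 ∧ z 1 < z 0 ∧ z 0 < c} →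
    Set.EqOn Tsrc.integrand
      (fun z => (g₂ * z 1 + 2 * g₃) / (4 * (z 1) ^ 2) / (Real.sqrt (f (z 0)) * Real.sqrt (f (z 1)))) Tsrc.domain →
    Ttgt.domain = {z | b' < z 1 ∧ z 1 < z 0 ∧ z 0 < c'} →
    Set.EqOn Ttgt.integrand
      (fun z => (g₂ * z 1 + 2 * g₃) / (4 * (z 1) ^ 2) / (Real.sqrt (f (z 0)) * Real.sqrt (f (z 1)))) Ttgt.domain →
    rO.domain = {t | b < t 0 ∧ t 0 < c} →
    Set.EqOn rO.integrand (fun t => (Qf b - Qf (t 0)) / Real.sqrt (f (t 0))) rO.domain →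
    Literature.NumberTheory.Transcendental.KZ.of Ttgt - Literature.NumberTheory.Transcendental.KZ.of Tsrc
      - Literature.NumberTheory.Transcendental.KZ.of rO ∈ Literature.NumberTheory.Transcendental.KZ.relations := by
  intro g₂ g₃ e₁ b c b' c' Cb f τ τ' Qf Tsrc Ttgt rO hf ag₂ ag₃ ab ac ab' ac' he₁ he₁b hbc he₁b' hb'c'
    hpos hCb hint hτmono hτimg hτder hτsa hQsa hQc hQd hSd hSi hTd hTi hOd hOi
  -- positivity of `f` on the two rows
  have hposA : ∀ x ∈ Ioo b c, 0 < f x := fun x hx => hpos x (he₁b.trans hx.1)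
  have hposA' : ∀ x ∈ Ioo b' c', 0 < f x := fun x hx => hpos x (he₁b'.trans_lt hx.1)
  -- the semialgebraic sets
  have hA : IsSemialgebraic ℚ {t : Fin 1 → ℝ | t 0 ∈ Ioo b c} :=
    IsSemialgebraicFunOn.isSemialgebraic_holds hτsa
  have hJ : IsSemialgebraic ℚ {t : Fin 1 → ℝ | t 0 ∈ Icc b c} :=
    IsSemialgebraicFunOn.isSemialgebraic_holds hQsa
  have hA' : IsSemialgebraic ℚ {t : Fin 1 → ℝ | t 0 ∈ Ioo b' c'} := by
    have e : {t : Fin 1 → ℝ | t 0 ∈ Ioo b' c'} =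
        {t : Fin 1 → ℝ | b' < t 0} ∩ {t : Fin 1 → ℝ | t 0 < c'} := by
      ext t
      simp
    rw [e]
    exact (isSemialgebraic_setOf_const_lt_apply ab' 0).inter
      (isSemialgebraic_setOf_apply_lt_const ac' 0)
  -- `τ` is injective on the row and maps it onto the next row
  have hinj : InjOn τ (Ioo b c) := (hτmono.mono Ioo_subset_Icc_self).injOn
  have hmaps : MapsTo τ (Ioo b c) (Ioo b' c') := (mapsTo_image τ (Ioo b c)).mono_right hτimg.subset
  -- the Haar identity `(√f(τ x))⁻¹ |τ′ x| = (√f x)⁻¹`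
  have hder : ∀ x ∈ Ioo b c, HasDerivAt τ (τ' x) x ∧
      (Real.sqrt (f (τ x)))⁻¹ * |τ' x| = (Real.sqrt (f x))⁻¹ := by
    intro x hx
    obtain ⟨hd, hhaar⟩ := hτder x hx
    refine ⟨hd, ?_⟩
    have hfτ : 0 < Real.sqrt (f (τ x)) := Real.sqrt_pos.2 (hposA' _ (hmaps hx))
    rw [← hhaar] at hfτ ⊢
    have hτ'0 : |τ' x| ≠ 0 := fun h0 => by
      rw [h0, zero_mul] at hfτ
      exact lt_irrefl 0 hfτ
    rw [mul_inv_rev, mul_assoc, inv_mul_cancel₀ hτ'0, mul_one]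
  -- the weight `1/√f` and the kernel `h` are `ℚ`-semialgebraic on the rows
  have hwA : IsSemialgebraicFunOn ℚ {t : Fin 1 → ℝ | t 0 ∈ Ioo b c}
      (fun t => (Real.sqrt (f (t 0)))⁻¹) :=
    (isSemialgebraicFunOn_sqrt_cubic_apply hA ag₂ ag₃ hf 0).inv fun t ht =>
      (Real.sqrt_pos.2 (hposA _ ht)).ne'
  have hwA' : IsSemialgebraicFunOn ℚ {t : Fin 1 → ℝ | t 0 ∈ Ioo b' c'}
      (fun t => (Real.sqrt (f (t 0)))⁻¹) :=
    (isSemialgebraicFunOn_sqrt_cubic_apply hA' ag₂ ag₃ hf 0).inv fun t ht =>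
      (Real.sqrt_pos.2 (hposA' _ ht)).ne'
  have hhA := upStep_isSemialgebraicFunOn_kernel hA ag₂ ag₃
  have hhA' := upStep_isSemialgebraicFunOn_kernel hA' ag₂ ag₃
  -- boundedness of the kernel, non-negativity of the weight
  have hhbA : ∀ x ∈ Ioo b c, |(g₂ * x + 2 * g₃) / (4 * x ^ 2)| ≤ Cb := fun x hx =>
    hCb x (he₁b.trans hx.1)
  have hhbA' : ∀ x ∈ Ioo b' c', |(g₂ * x + 2 * g₃) / (4 * x ^ 2)| ≤ Cb := fun x hx =>
    hCb x (he₁b'.trans_lt hx.1)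
  have hwnn : ∀ x ∈ Ioo b c, 0 ≤ (Real.sqrt (f x))⁻¹ := fun x _ =>
    inv_nonneg.2 (Real.sqrt_nonneg _)
  -- the fibre end points `c = const b`, `d = id`
  have hcsa : IsSemialgebraicFunOn ℚ {t : Fin 1 → ℝ | t 0 ∈ Ioo b c} (fun _ => b) :=
    isSemialgebraicFunOn_const_of_isAlgebraic hA ab
  have hdsa : IsSemialgebraicFunOn ℚ {t : Fin 1 → ℝ | t 0 ∈ Ioo b c} (fun t => t 0) :=
    (isSemialgebraicFunOn_aeval hA (X 0)).congr fun x _ => by simp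
  have hcd : ∀ x ∈ Ioo b c, b < x := fun x hx => hx.1
  have hJcd : ∀ x ∈ Ioo b c, Icc b x ⊆ Icc b c := fun x hx => Icc_subset_Icc_right hx.2.le
  have hBcd : ∀ x ∈ Ioo b c, Ioo b x ⊆ Ioo b c := fun x hx => Ioo_subset_Ioo_right hx.2.le
  -- the potential on the fibres
  have hQc' : ∀ x ∈ Ioo b c, ContinuousOn Qf (Icc b x) := fun x hx =>
    hQc.mono (Icc_subset_Icc_right hx.2.le)
  have hQd' : ∀ x ∈ Ioo b c, ∀ x' ∈ Ioo b x, HasDerivAt Qf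
      (-(((g₂ * τ x' + 2 * g₃) / (4 * τ x' ^ 2) - (g₂ * x' + 2 * g₃) / (4 * x' ^ 2)) *
        (Real.sqrt (f x'))⁻¹)) x' := by
    intro x hx x' hx'
    have h := hQd x' (hBcd x hx hx')
    rwa [div_neg, div_eq_mul_inv] at h
  -- the three representations in the shape of `stub_translationStep`
  have hSd' : Tsrc.domain = {z : Fin 2 → ℝ | z 0 ∈ Ioo b c ∧ b < z 1 ∧ z 1 < z 0} := by
    rw [hSd]
    ext z
    simp only [mem_setOf_eq, mem_Ioo]
    constructor
    · rintro ⟨h1, h2, h3⟩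
      exact ⟨⟨h1.trans h2, h3⟩, h1, h2⟩
    · rintro ⟨⟨_, h3⟩, h1, h2⟩
      exact ⟨h1, h2, h3⟩
  have hSi' : EqOn Tsrc.integrand (fun z => (g₂ * z 1 + 2 * g₃) / (4 * z 1 ^ 2) *
      (Real.sqrt (f (z 0)))⁻¹ * (Real.sqrt (f (z 1)))⁻¹) Tsrc.domain := fun z hz => by
    rw [hSi hz]
    dsimp only
    ring
  have hTd' : Ttgt.domain =
      (fun z : Fin 2 → ℝ => (![τ (z 0), τ (z 1)] : Fin 2 → ℝ)) '' Tsrc.domain := by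
    rw [hTd, hSd]
    exact upStep_image_triangle hτmono hτimg
  have hTi' : EqOn Ttgt.integrand (fun z => (g₂ * z 1 + 2 * g₃) / (4 * z 1 ^ 2) *
      (Real.sqrt (f (z 0)))⁻¹ * (Real.sqrt (f (z 1)))⁻¹) Ttgt.domain := fun z hz => by
    rw [hTi hz]
    dsimp only
    ring
  have hOd' : rO.domain = {t : Fin 1 → ℝ | t 0 ∈ Ioo b c} := hOd
  have hOi' : EqOn rO.integrand (fun t => (Qf b - Qf (t 0)) * (Real.sqrt (f (t 0)))⁻¹)
      rO.domain := fun t ht => by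
    rw [hOi ht]
    dsimp only
    rw [div_eq_mul_inv]
  -- ONE application of the generic translation step
  exact stub_translationStep τ τ' τ τ' (fun x => (g₂ * x + 2 * g₃) / (4 * x ^ 2))
    (fun x => (g₂ * x + 2 * g₃) / (4 * x ^ 2)) (fun t => (Real.sqrt (f t))⁻¹)
    (fun t => (Real.sqrt (f t))⁻¹) (fun t => (Real.sqrt (f t))⁻¹) (fun t => (Real.sqrt (f t))⁻¹) Qf
    (fun _ => b) (fun x => x) (Ioo b c) (Ioo b c) (Ioo b' c') (Ioo b' c') (Icc b c) Cb Tsrc Ttgt rO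
    hA hA hA' hA' hJ hτsa hτsa hinj hinj hmaps hmaps hder hder hwA hwA hwA' hwA' hhA hhA' hhbA hhbA'
    hwnn hwnn hint hint hcsa hdsa hcd hJcd hBcd hQsa hQc' hQd' hSd' hSi' hTd' hTi' hOd' hOi'

end Summit.KontsevichZagierPeriods.KontsevichZagierPeriods.Cruxes.NeronTorsionSector.Translation

end
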